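import Literature.AlgebraicGeometry.Resolution.TameTowerInertiaField
import Mathlib.FieldTheory.PurelyInseparable.PerfectClosure
import Mathlib.GroupTheory.PGroup
import HarnessLib

/-!
# The inertia group of a finite Galois extension with stable valuation ring, II: unramified

Topic: `Literature/AlgebraicGeometry/Resolution` (valued function fields). Continuation of
`TameTowerInertiaField.lean` (setting and notation there: `(Ω, V)`, `F ≤ Ω`, `L|F` finite
Galois inside `Ω` with `V` stable under `Gal(L|F)`, inertia group `I`, residue fields
`Fv ≤ Tv ≤ Lv ≤ Ωv` for the inertia field `T = L^I`), towards the reduction step of F.-V.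
Kuhlmann, *Elimination of ramification I*, Trans. AMS 362 (2010) = arXiv:1003.5678, §5, proof of
(R4), pp. 18–19 and Lemma 2.27 (`Kuhlmann2010TameTowerReduction`). PROVED:

* `pow_card_mem_residueSubfield_fixedField` — the norm trick: for `ᾱ ∈ Lv`, `ᾱ^{|I|} ∈ Tv`
  (the norm `∏_{σ ∈ I} σ α` lies in `T ∩ V` and has residue `ᾱ^{|I|}`).
* `lift_separableClosure_le_fixedField` — if `I` is a `p`-group (`p = char Ωv`) then
  `(Lv)_s ≤ Tv`: an element separable over `Fv ≤ Tv` with a `p`-power in `Tv` lies in `Tv`.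
* `isUnramifiedOver_fixedField_inertia` — **if `I` is a `p`-group then `T|F` is unramified**
  (`IsUnramifiedOver`, `HenselizedFunctionFields.lean`): with the fundamental inequality and
  `index_inertia_le_finrank_separableClosure`,
  `[Tv : Fv] ≤ (vT : vF)[Tv : Fv] ≤ [T : F] = [G : I] ≤ [(Lv)_s : Fv] ≤ [Tv : Fv]`, so
  equality holds throughout: `vT = vF`, `[T : F] = [Tv : Fv]`, and `Tv = (Lv)_s` is separable
  over `Fv`.
  (In general `I` has a normal `p`-Sylow subgroup with quotient of order prime to `p` — tame
  ramification; it is absent in the application, `TameTowerInertiaPGroup.lean`, where the value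
  group of `F` is divisible.)

## Sources

* Classical ramification theory: O. Endler, *Valuation theory* (1972), §19–20; Kuhlmann 2010,
  §1.1–1.2 ("unramified": residue fields separable of the full degree, equal value groups;
  subextensions of the absolute inertia field). [folklore]
-/

noncomputable section

open Module IntermediateField IsLocalRing

namespace Literature.AlgebraicGeometry.Resolution

universe u

variable {Ω : Type u} [Field Ω] {V : ValuationSubring Ω}
variable {F : Subfield Ω} {L : IntermediateField F Ω}

/-! ### The norm trick: `ᾱ ^ |I| ∈ Tv` -/

/-- **The norm trick**: for a subgroup `I` of `Gal(L|F)` acting trivially on residues and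
`α ∈ L ∩ V` with residue `ᾱ`, the power `ᾱ^{|I|}` lies in the residue field `Tv` of the
fixed field `T = L^I`: it is the residue of the norm `∏_{σ ∈ I} σ α ∈ T ∩ V`.
[folklore] -/
theorem pow_card_mem_residueSubfield_fixedField
    (hV : ∀ (σ : L ≃ₐ[F] L) (x : L), (x : Ω) ∈ V ↔ ((σ x : L) : Ω) ∈ V)
    [FiniteDimensional F L] (I : Subgroup (L ≃ₐ[F] L))
    (hI : ∀ σ ∈ I, ∀ x : L, (x : Ω) ∈ V → V.valuation (((σ x : L) : Ω) - x) < 1)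
    (α : L) (hα : (α : Ω) ∈ V) :
    residue V ⟨α, hα⟩ ^ Nat.card I ∈
      residueSubfield (lift (fixedField I)).toSubfield V := by
  classical
  haveI : Fintype I := Fintype.ofFinite I
  let β : L := ∏ σ : I, (σ : L ≃ₐ[F] L) α
  -- `β` is fixed by `I`
  have hβfix : β ∈ fixedField I := by
    rw [IntermediateField.mem_fixedField_iff]
    intro τ hτ
    change τ (∏ σ : I, (σ : L ≃ₐ[F] L) α) = ∏ σ : I, (σ : L ≃ₐ[F] L) α
    rw [map_prod]
    exact Fintype.prod_equiv (Equiv.mulLeft ⟨τ, hτ⟩) _ _ fun σ => rfl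
  -- `β ∈ V`, with residue `ᾱ ^ |I|`
  have hmemV : ∀ σ : I, (((σ : L ≃ₐ[F] L) α : L) : Ω) ∈ V := fun σ => (hV σ α).mp hα
  have hβ : (β : Ω) ∈ V := by
    change ((∏ σ : I, (σ : L ≃ₐ[F] L) α : L) : Ω) ∈ V
    push_cast
    exact prod_mem fun σ _ => hmemV σ
  have hres : residue V ⟨β, hβ⟩ = residue V ⟨α, hα⟩ ^ Nat.card I := by
    have h1 : (⟨(β : Ω), hβ⟩ : V) =
        ∏ σ : I, ⟨(((σ : L ≃ₐ[F] L) α : L) : Ω), hmemV σ⟩ := by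
      apply Subtype.ext
      change ((∏ σ : I, (σ : L ≃ₐ[F] L) α : L) : Ω) = _
      push_cast
      rfl
    rw [h1, map_prod]
    have h2 : ∀ σ : I,
        residue V ⟨(((σ : L ≃ₐ[F] L) α : L) : Ω), hmemV σ⟩ = residue V ⟨α, hα⟩ :=
      fun σ => (residue_mk_eq_iff V _ _).mpr (hI σ σ.2 α hα)
    simp only [h2, Finset.prod_const, Finset.card_univ, Nat.card_eq_fintype_card]
  rw [← hres]
  exact (mem_residueSubfield_iff (lift (fixedField I)).toSubfield V _).mpr
    ⟨⟨(β : Ω), (mem_lift β).mpr hβfix⟩, hβ, rfl⟩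

/-! ### The inertia field is unramified when the inertia group is a `p`-group -/

/-- Separability of an element of an intermediate field does not depend on where it is read.
[folklore] -/
theorem isSeparable_coe_iff {K E : Type*} [Field K] [Field E] [Algebra K E]
    {S : IntermediateField K E} (x : S) : IsSeparable K (x : E) ↔ IsSeparable K x := by
  rw [IsSeparable, IsSeparable, IntermediateField.minpoly_eq]

/-- `Lv` (as an intermediate field over `Fv`) is finite over `Fv` when `L|F` is finite (the
fundamental inequality). [folklore] -/
theorem finiteDimensional_residueSubfield [FiniteDimensional F L] :
    FiniteDimensional (residueSubfield F V)
      (Subfield.extendScalars (residueSubfield_base_le V L)) := by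
  have hle : F ≤ L.toSubfield := subfield_le_toSubfield L
  have hpos : 0 < Subfield.relfinrank F L.toSubfield := by
    rw [relfinrank_toSubfield_eq_finrank]
    exact finrank_pos
  obtain ⟨-, hf, -⟩ := relIndex_mul_relfinrank_le_relfinrank (V := V) hle hpos
  have hr : residueSubfield L.toSubfield V = residueSubfield L V :=
    residueSubfield_eq_of_range_eq V (by
      rw [range_algebraMap_subfield, range_algebraMap_intermediateField]
      rfl)
  rw [hr, Subfield.relfinrank_eq_finrank_of_le (residueSubfield_base_le V L)] at hf
  exact Module.finite_of_finrank_pos hf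

variable (V) in
/-- `Fv ≤ Tv` for the fixed field `T = L^I` of a subgroup `I ≤ Gal(L|F)`. [folklore] -/
theorem residueSubfield_base_le_fixedField (I : Subgroup (L ≃ₐ[F] L)) :
    residueSubfield F V ≤ residueSubfield (lift (fixedField I)).toSubfield V :=
  residueSubfield_subfield_mono (le_lift_toSubfield (fixedField I))

/-- `Tv ≤ Lv` for the fixed field `T = L^I`. [folklore] -/
theorem residueSubfield_fixedField_le (I : Subgroup (L ≃ₐ[F] L)) :
    residueSubfield (lift (fixedField I)).toSubfield V ≤ residueSubfield L V := by
  have h1 : residueSubfield (lift (fixedField I)).toSubfield V ≤ residueSubfield L.toSubfield V :=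
    residueSubfield_subfield_mono (lift_toSubfield_le (fixedField I))
  have hr : residueSubfield L.toSubfield V = residueSubfield L V :=
    residueSubfield_eq_of_range_eq V (by
      rw [range_algebraMap_subfield, range_algebraMap_intermediateField]
      rfl)
  rwa [hr] at h1

/-- **`(Lv)_s ≤ Tv` when `I` is a `p`-group**: an element of `Lv` separable over `Fv` has, by the
norm trick, a `p^m`-th power (`p^m = |I|`) in `Tv`; being separable over `Tv ≥ Fv` and purely
inseparable over `Tv`, it lies in `Tv`. [folklore] -/
theorem lift_separableClosure_le_fixedField {p : ℕ} [hp : Fact p.Prime] [CharP (ResidueField V) p]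
    (hV : ∀ (σ : L ≃ₐ[F] L) (x : L), (x : Ω) ∈ V ↔ ((σ x : L) : Ω) ∈ V)
    [FiniteDimensional F L] (I : Subgroup (L ≃ₐ[F] L))
    (hI : ∀ σ ∈ I, ∀ x : L, (x : Ω) ∈ V → V.valuation (((σ x : L) : Ω) - x) < 1)
    (hIp : IsPGroup p I) :
    lift (separableClosure (residueSubfield F V)
        (Subfield.extendScalars (residueSubfield_base_le V L))) ≤
      Subfield.extendScalars (residueSubfield_base_le_fixedField V I) := by
  haveI : ExpChar (ResidueField V) p := ExpChar.prime hp.out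
  obtain ⟨m, hm⟩ := hIp.exists_card_eq
  intro r hr
  have hrℓ : r ∈ Subfield.extendScalars (residueSubfield_base_le V L) := lift_le _ hr
  have hy : (⟨r, hrℓ⟩ : Subfield.extendScalars (residueSubfield_base_le V L)) ∈
      separableClosure (residueSubfield F V)
        (Subfield.extendScalars (residueSubfield_base_le V L)) :=
    (mem_lift (⟨r, hrℓ⟩ : Subfield.extendScalars (residueSubfield_base_le V L))).mp hr
  have hysep : IsSeparable (residueSubfield F V) r :=
    (isSeparable_coe_iff
      (⟨r, hrℓ⟩ : Subfield.extendScalars (residueSubfield_base_le V L))).mpr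
      (mem_separableClosure_iff.mp hy)
  -- `r` is the residue of some `α ∈ L ∩ V`; its `p^m`-th power lies in `Tv`
  obtain ⟨α, hα, hαr⟩ := (mem_residueSubfield_intermediateField_iff V r).mp hrℓ
  have hpow : r ^ p ^ m ∈ residueSubfield (lift (fixedField I)).toSubfield V := by
    rw [← hαr, ← hm]
    exact pow_card_mem_residueSubfield_fixedField hV I hI α hα
  -- separable and purely inseparable over `Tv`, hence in `Tv`
  have h1 : r ∈ perfectClosure (Subfield.extendScalars (residueSubfield_base_le_fixedField V I))
      (ResidueField V) := by
    rw [mem_perfectClosure_iff_pow_mem p]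
    exact ⟨m, ⟨⟨_, hpow⟩, rfl⟩⟩
  have h2 : r ∈ separableClosure (Subfield.extendScalars (residueSubfield_base_le_fixedField V I))
      (ResidueField V) :=
    mem_separableClosure_iff.mpr (IsSeparable.tower_top _ hysep)
  have h3 : r ∈ separableClosure (Subfield.extendScalars (residueSubfield_base_le_fixedField V I))
      (ResidueField V) ⊓
        perfectClosure (Subfield.extendScalars (residueSubfield_base_le_fixedField V I))
          (ResidueField V) := ⟨h2, h1⟩
  rw [separableClosure_inf_perfectClosure, IntermediateField.mem_bot] at h3
  obtain ⟨c, hc⟩ := h3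
  rw [← hc]
  exact c.2

/-- **The inertia field `T = L^I` is a finite unramified extension of `F` when the inertia group
`I` is a `p`-group** (`p` the residue characteristic): inside an algebraically closed `(Ω, V)`,
for `L|F` finite Galois with `V` stable under `Gal(L|F)`. Proof: `(Lv)_s ≤ Tv`
(`lift_separableClosure_le_fixedField`), so with the fundamental inequality and
`index_inertia_le_finrank_separableClosure`,
`[Tv : Fv] ≤ (vT : vF)[Tv : Fv] ≤ [T : F] = [G : I] ≤ [(Lv)_s : Fv] ≤ [Tv : Fv]`: equality
throughout, i.e. `vT = vF`, `[T : F] = [Tv : Fv]`, and `Tv = (Lv)_s` is separable over `Fv`.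
(Kuhlmann 2010, §1.1–1.2: finite subextensions of the absolute inertia field are the finite
unramified ones; here for the relative inertia field, without Hensel's Lemma.)
[cite: Kuhlmann2010, Section 1.1 and Section 1.2] -/
theorem isUnramifiedOver_fixedField_inertia [IsAlgClosed Ω] {p : ℕ} [hp : Fact p.Prime]
    [CharP (ResidueField V) p]
    (hV : ∀ (σ : L ≃ₐ[F] L) (x : L), (x : Ω) ∈ V ↔ ((σ x : L) : Ω) ∈ V)
    [FiniteDimensional F L] [IsGalois F L] (I : Subgroup (L ≃ₐ[F] L))
    (hI : ∀ σ, σ ∈ I ↔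
      ∀ x : L, (x : Ω) ∈ V → V.valuation (((σ x : L) : Ω) - x) < 1)
    (hIp : IsPGroup p I) :
    IsUnramifiedOver V F (lift (fixedField I)).toSubfield := by
  classical
  have hFT : F ≤ (lift (fixedField I)).toSubfield := le_lift_toSubfield (fixedField I)
  -- `[T : F] = [G : I] > 0`
  have hn : Subfield.relfinrank F (lift (fixedField I)).toSubfield = I.index := by
    rw [relfinrank_toSubfield_eq_finrank,
      ← (liftAlgEquiv (fixedField I)).toLinearEquiv.finrank_eq,
      IntermediateField.finrank_eq_fixingSubgroup_index,
      IntermediateField.fixingSubgroup_fixedField]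
  haveI : I.FiniteIndex := Subgroup.finiteIndex_of_finite
  have hnpos : 0 < Subfield.relfinrank F (lift (fixedField I)).toSubfield := by
    rw [hn]; exact Nat.pos_of_ne_zero Subgroup.FiniteIndex.index_ne_zero
  -- the fundamental inequality `e f ≤ n`
  obtain ⟨hepos, hfpos, hef⟩ := relIndex_mul_relfinrank_le_relfinrank (V := V) hFT hnpos
  have hf : Subfield.relfinrank (residueSubfield F V)
      (residueSubfield (lift (fixedField I)).toSubfield V) =
        finrank (residueSubfield F V)
          (Subfield.extendScalars (residueSubfield_base_le_fixedField V I)) :=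
    Subfield.relfinrank_eq_finrank_of_le _
  haveI : FiniteDimensional (residueSubfield F V)
      (Subfield.extendScalars (residueSubfield_base_le_fixedField V I)) := by
    rw [hf] at hfpos
    exact Module.finite_of_finrank_pos hfpos
  haveI : FiniteDimensional (residueSubfield F V)
      (Subfield.extendScalars (residueSubfield_base_le V L)) := finiteDimensional_residueSubfield
  -- `[G : I] ≤ [(Lv)_s : Fv] ≤ [Tv : Fv]`
  have hcount := index_inertia_le_finrank_separableClosure hV I hI
  have hsub := lift_separableClosure_le_fixedField hV I (fun σ hσ => (hI σ).mp hσ) hIp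
  have hsf : finrank (residueSubfield F V) (separableClosure (residueSubfield F V)
      (Subfield.extendScalars (residueSubfield_base_le V L))) ≤
        finrank (residueSubfield F V)
          (Subfield.extendScalars (residueSubfield_base_le_fixedField V I)) := by
    rw [(liftAlgEquiv (separableClosure (residueSubfield F V)
      (Subfield.extendScalars (residueSubfield_base_le V L)))).toLinearEquiv.finrank_eq]
    exact IntermediateField.finrank_le_of_le_right hsub
  -- equality throughout
  have hnf : Subfield.relfinrank F (lift (fixedField I)).toSubfield =
      finrank (residueSubfield F V)
        (Subfield.extendScalars (residueSubfield_base_le_fixedField V I)) := by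
    apply le_antisymm
    · rw [hn]; exact hcount.trans hsf
    · rw [← hf]
      exact (Nat.le_mul_of_pos_left _ hepos).trans hef
  have he :
      (valueSubgroup F V).relIndex (valueSubgroup (lift (fixedField I)).toSubfield V) = 1 := by
    rw [hnf, hf] at hef
    have hfpos' : 0 < finrank (residueSubfield F V)
        (Subfield.extendScalars (residueSubfield_base_le_fixedField V I)) := by
      rw [← hf]; exact hfpos
    have h1 : (valueSubgroup F V).relIndex (valueSubgroup (lift (fixedField I)).toSubfield V) *
        finrank (residueSubfield F V)
          (Subfield.extendScalars (residueSubfield_base_le_fixedField V I)) ≤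
        1 * finrank (residueSubfield F V)
          (Subfield.extendScalars (residueSubfield_base_le_fixedField V I)) := by
      rwa [one_mul]
    have h2 := Nat.le_of_mul_le_mul_right h1 hfpos'
    omega
  have heq : lift (separableClosure (residueSubfield F V)
      (Subfield.extendScalars (residueSubfield_base_le V L))) =
        Subfield.extendScalars (residueSubfield_base_le_fixedField V I) := by
    apply IntermediateField.eq_of_le_of_finrank_eq hsub
    rw [← (liftAlgEquiv (separableClosure (residueSubfield F V)
      (Subfield.extendScalars (residueSubfield_base_le V L)))).toLinearEquiv.finrank_eq]
    exact le_antisymm hsf (by rw [← hnf, hn]; exact hcount)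
  refine ⟨hFT, hnpos, by rw [hnf, hf], ?_, ?_⟩
  · -- `Tv = (Lv)_s` is separable over `Fv`
    intro r hr
    have hr' : r ∈ lift (separableClosure (residueSubfield F V)
        (Subfield.extendScalars (residueSubfield_base_le V L))) := by rw [heq]; exact hr
    have hrℓ : r ∈ Subfield.extendScalars (residueSubfield_base_le V L) := lift_le _ hr'
    have hy :=
      (mem_lift (⟨r, hrℓ⟩ : Subfield.extendScalars (residueSubfield_base_le V L))).mp hr'
    exact (isSeparable_coe_iff
      (⟨r, hrℓ⟩ : Subfield.extendScalars (residueSubfield_base_le V L))).mpr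
      (mem_separableClosure_iff.mp hy)
  · -- `vT = vF`
    exact le_antisymm (Subgroup.relIndex_eq_one.mp he) (valueSubgroup_subfield_mono hFT)

end Literature.AlgebraicGeometry.Resolution
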